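import Summits.BirchSwinnertonDyer.BirchSwinnertonDyer.Theses.TwistFamilyManinDescent
import Literature.NumberTheory.EllipticCurves.CuspFormTwist
import Literature.NumberTheory.EllipticCurves.ModularForms.NewformWithNebentypus

/-!
# Sketch — crux idea `half-twist-raynaud-window` for
`TwistFamilyManinDescent.EisensteinAdditiveManinResidual` (stmt-BirchSwinnertonDyer-25138)

First lemma (L0 `HalfTwistLevelDrop`), the instrument object (`halfTwistPeriods`, support lemma
`HalfTwistPeriodInclusion`) and the CALIBRATED law statements (`HalfTwistOptimalityLaw`,
`HalfTwistPartnerLaw`; kit jobs j314433/j314435/j314436/j314492 + Kodaira dictionary j314602).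
Statements only (no proofs, no sorry).
-/

open scoped MatrixGroups ModularForm
open CongruenceSubgroup
open Literature.NumberTheory.EllipticCurves.ModularForms

namespace Summit.BirchSwinnertonDyer.BirchSwinnertonDyer.Cruxes.EisensteinAdditiveManinResidual.HalfTwistRaynaudWindow

/-- **L0 — half-twist level drop with nebentypus (first lemma of the line).** For a globally minimal
`W/ℚ` with additive potentially good reduction at `p ≥ 5` of PRINCIPAL-SERIES type
(`e = 12/gcd(12, v_p Δ_min)` divides `p − 1`) and newform `f = D.f` of level `N = p²M`, `p ∤ M`:
there is a Dirichlet character `χ mod p` of order `e` (the inverse Teichmüller power `ε̃^{-j}` of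
the inertial character) and a NEWFORM `g` of level `pM` (one `p` less) with nebentypus `χ²`
(of order `e / gcd(2,e) ∈ {2,3}`, conductor `p`) such that the raw twist of `f` by `χ` is the
`p`-stabilisation of `g`:  `∑_{u mod p} χ̄(u) f(τ + u/p) = G(χ̄) · (g(τ) − a_p(g) g(pτ))`.
(Atkin–Li 1978 Thm 3.1 + local Langlands for PS(μ, μ⁻¹): cond(ρ_f ⊗ χ) = cond(1) + cond(χ²) = 1.)
The residual inertia of `g` is `1 ⊕ χ²|_I` of order `e' ≤ 3 < p − 1`: this is the Raynaud window
the line works in, INCLUDING the corner `(p, e) ∈ {(5,4), (7,6)}`. -/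
def HalfTwistLevelDrop : Prop :=
  ∀ (W : WeierstrassCurve ℚ) [W.IsElliptic] [W.IsGloballyMinimal] (p : ℕ) [Fact p.Prime]
    [NeZero (W.conductorNorm ℤ)] (D : ModularParametrizationData W (W.conductorNorm ℤ))
    (hsq : p ^ 2 ∣ W.conductorNorm ℤ) (M : ℕ) [NeZero (p * M)],
    5 ≤ p → W.conductorNorm ℤ = p ^ 2 * M → ¬ p ∣ M →
    0 ≤ padicValRat p W.j →
    (12 / Nat.gcd 12 (padicValInt p W.minimalDiscriminantInt)) ∣ (p - 1) →
    ∃ χ : DirichletCharacter ℂ p,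
      orderOf χ = 12 / Nat.gcd 12 (padicValInt p W.minimalDiscriminantInt) ∧
      ∃ g : CuspForm (Gamma1 (p * M)) 2,
        IsNewformWithNebentypus ((χ ^ 2).changeLevel (dvd_mul_right p M)) g ∧
        ∀ τ τ' : UpperHalfPlane, (τ' : ℂ) = (p : ℂ) * (τ : ℂ) →
          (twistRaw (W.conductorNorm ℤ) (dvd_refl _) hsq D.f χ) τ =
            gaussSum χ⁻¹ (ZMod.stdAddChar (N := p)) * (g τ - cuspCoeff g p * g τ')

/-- The **half-twist period module** `P(f, χ)`, realised faithfully in `ℂ × ℂ` through the pair of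
embeddings `(id, conj)` of the coefficient ring `ℤ[χ]` (so that it is the FORMAL module
`ℤ[χ] ⊗ Λ_f`-image even for CM curves, where `ℤ[χ]·Λ_f ⊂ ℂ` would collapse): generated by
`(∑_u χ̄(u)·{∞, γ∞ + u/p}_f , ∑_u χ(u)·{∞, γ∞ + u/p}_f)` over `γ ∈ Γ_{χ²}(N) := {γ ∈ Γ₀(N) |
χ(d_γ)² = 1}` (index `ord χ² ≤ 3` in `Γ₀(N)`) — i.e. (for `p² ∣ N`) the periods of the raw twists
`∑_u χ̄(u) f(τ + u/p) = G(χ̄)(g − a_p(g) g(p·))` and its conjugate over `H₁(X_{χ²}(N), ℤ)`, written in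
`f`'s own modular symbols. `ℤ`-rank `2φ(ord χ)`; c-free and computable (kit `halftwist2.gp`).
Topological meaning: `c · P(f,χ) = Ψ_{χ,*} H₁(X(Γ₀(p²M) ∩ Γ₁(p)), ℤ)` inside
`H₁((Res_{F_e/ℚ}E)_χ, ℤ) = ℤ[χ] ⊗ Λ_E = c · (ℤ[χ] ⊗ Λ_f)`, so `[ℤ[χ]Λ_f : P(f,χ)] = |π₀(ker Ψ_χ)|`. -/
noncomputable def halfTwistPeriods {N : ℕ} (f : CuspForm (Gamma0 N) 2) {p : ℕ} [NeZero p]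
    (χ : DirichletCharacter ℂ p) : AddSubgroup (ℂ × ℂ) :=
  AddSubgroup.closure {z : ℂ × ℂ | ∃ γ : Gamma0 N, ((γ : SL(2, ℤ)) 1 0) ≠ 0 ∧
    χ ((((γ : SL(2, ℤ)) 1 1 : ℤ) : ZMod p)) ^ 2 = 1 ∧
    z = (∑ u : ZMod p, χ⁻¹ u *
          modularSymbol f ((((γ : SL(2, ℤ)) 0 0 : ℤ) : ℚ) / (((γ : SL(2, ℤ)) 1 0 : ℤ) : ℚ) +
            twistShift u),
         ∑ u : ZMod p, χ u *
          modularSymbol f ((((γ : SL(2, ℤ)) 0 0 : ℤ) : ℚ) / (((γ : SL(2, ℤ)) 1 0 : ℤ) : ℚ) +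
            twistShift u))}

/-- The faithful `(id, conj)`-realisation of `ℤ[χ] ⊗ Λ` in `ℂ × ℂ` for an additive subgroup
`Λ ⊆ ℂ`: generated by `(χ(u)·w, χ̄(u)·w)`, `w ∈ Λ`. (Injective on the formal tensor as soon as
`Λ` is a lattice, since `ℚ(χ) ∩ ℝ = ℚ` for `ord χ ∈ {3,4,6}`.) -/
def cycSpan (Λ : AddSubgroup ℂ) {p : ℕ} (χ : DirichletCharacter ℂ p) : AddSubgroup (ℂ × ℂ) :=
  AddSubgroup.closure {z : ℂ × ℂ | ∃ u : ZMod p, ∃ w ∈ Λ, z = (χ u * w, χ⁻¹ u * w)}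

/-- **Support (easy inclusion, Shimura 3.64 / Stevens (5.4) shape):** `P(f, χ) ⊆ ℤ[χ]·Λ_f` when
`p² ∣ N` (each `{∞, γ∞ + u/p}_f` is a `Γ₀(N)`-period of `f`, tree lemma
`exists_modularSymbol_add_twistShift_eq_cuspSymbol`; `χ⁻¹ u = χ̄ u`). -/
def HalfTwistPeriodInclusion : Prop :=
  ∀ {N : ℕ} [NeZero N] (p : ℕ) [NeZero p], p ^ 2 ∣ N →
    ∀ (f : CuspForm (Gamma0 N) 2) (χ : DirichletCharacter ℂ p),
      halfTwistPeriods f χ ≤ cycSpan (periodLattice f) χ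

/-- **TWISTED-OPTIMALITY LAW (CALIBRATED — kit j314433/j314435/j314436 + Kodaira dictionary
j314602; c-free; Eisenstein-blind).** For a principal-series row and a level-dropping character `χ`
of order `e`, the half-twist index `[ℤ[χ]Λ_f : P(f, χ)] = |π₀(ker Ψ_χ)|` (`Ψ_χ` = the `χ`-twisted
parametrisation `J(Γ₀(p²M) ∩ Γ₁(p)) → (Res_{F_e/ℚ} E)_χ`) equals `1` on the UNSTARRED fibres
(`II, III, IV`: `v_p Δ_min ∈ {2,3,4}`) and `p²` on the STARRED fibres (`IV*, III*, II*`: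
`v_p Δ_min ∈ {8,9,10}`), the `p²` sitting at the single prime `𝔭 ∋ a_p(f ⊗ χ)` of `ℤ[χ]`
(equivalently: at `𝔭`, `χ ≡ ω^{(p-1)·v_pΔ_min/12}`; defect iff this exponent is `-(p-1)/e`).
Observed: `150a1=[1,0,0,-3,-3]` III → 1, its `5*`-partner `[1,1,0,-75,-375]` III* → 25 (both with
`E[5]` REDUCIBLE); N = 175: III → 1, III* → 25 (reducible); N = 200: III → 1, III* → 25; N = 147,
196 (p = 7): II → 1, IV* → 49; N = 338 (p = 13): II → 1, IV* → 169, III → 1, III* → 169.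
The earlier guess "equal indices for `E` and `E*`" is REFUTED by the same table. -/
def HalfTwistOptimalityLaw : Prop :=
  ∀ (W : WeierstrassCurve ℚ) [W.IsElliptic] [W.IsGloballyMinimal] (p : ℕ) [Fact p.Prime]
    [NeZero (W.conductorNorm ℤ)] (D : ModularParametrizationData W (W.conductorNorm ℤ)),
    p ^ 2 ∣ W.conductorNorm ℤ → 5 ≤ p → 0 ≤ padicValRat p W.j →
    (12 / Nat.gcd 12 (padicValInt p W.minimalDiscriminantInt)) ∣ (p - 1) →
    ∀ (χ : DirichletCharacter ℂ p),
      orderOf χ = 12 / Nat.gcd 12 (padicValInt p W.minimalDiscriminantInt) →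
        (padicValInt p W.minimalDiscriminantInt < 6 →
          (halfTwistPeriods D.f χ).relIndex (cycSpan (periodLattice D.f) χ) = 1) ∧
        (6 < padicValInt p W.minimalDiscriminantInt →
          (halfTwistPeriods D.f χ).relIndex (cycSpan (periodLattice D.f) χ) = p ^ 2)

/-- **Partner form of the law (CALIBRATED, same jobs).** `E` and its
`p*`-partner `E* = E ⊗ χ_{p*}` share the half-twist newform `g` (`χ* = χ·χ_{p*}`); exactly one of
the two twisted parametrisations is optimal and the other has defect `p²`:
`[ℤ[χ]Λ_f : P(f, χ)] · [ℤ[χ*]Λ_{f*} : P(f*, χ*)] = p²` (observed `25·1` at N = 150, 175, 200;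
`169·1` at N = 338, both characters `χ, χ̄`). Conjectural dictionary: the optimal member is the
UNSTARRED fibre (`v_p Δ_min < 6`), i.e. `χ ≡ ω^{(p-1)v/12}` (mod 𝔭 ∋ a_p(f⊗χ)). -/
def HalfTwistPartnerLaw : Prop :=
  ∀ (W : WeierstrassCurve ℚ) [W.IsElliptic] [W.IsGloballyMinimal] (p : ℕ) [Fact p.Prime]
    [NeZero (W.conductorNorm ℤ)] (D : ModularParametrizationData W (W.conductorNorm ℤ))
    (hsq : p ^ 2 ∣ W.conductorNorm ℤ),
    5 ≤ p → 0 ≤ padicValRat p W.j →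
    (12 / Nat.gcd 12 (padicValInt p W.minimalDiscriminantInt)) ∣ (p - 1) →
    ∀ (χ : DirichletCharacter ℂ p),
      orderOf χ = 12 / Nat.gcd 12 (padicValInt p W.minimalDiscriminantInt) →
      ∀ (χ₂ : DirichletCharacter ℂ p) (hχ₂ : χ₂.IsQuadratic), χ₂.IsPrimitive →
        (halfTwistPeriods D.f χ).relIndex (cycSpan (periodLattice D.f) χ) *
          (halfTwistPeriods (charTwist (W.conductorNorm ℤ) (dvd_refl _) hsq hχ₂ D.f) (χ * χ₂)).relIndex
            (cycSpan (periodLattice (charTwist (W.conductorNorm ℤ) (dvd_refl _) hsq hχ₂ D.f)) (χ * χ₂))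
          = p ^ 2

end Summit.BirchSwinnertonDyer.BirchSwinnertonDyer.Cruxes.EisensteinAdditiveManinResidual.HalfTwistRaynaudWindow
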